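import Summits.MatrixMultiplication.MatrixMultiplication.Theorems.AbelianSTPPCensusTAKnap473Defs

/-!
# T_A/473 certificate: the knapsack rows dominate, and the candidate enumeration is complete

Cell mm-stpp (rung F-M1), OPTIONAL rung leaf T_A/473 `NoAbelianSTPPHost_2371_473`; design in the module docstring of
`AbelianSTPPCensusTAKnap473Defs.lean`.  This file is `AbelianSTPPCensusTAKnapRows.lean` (T_A/450, p463633) VERBATIM in the namespace
`TAKnap473` (universe `Mtop = 473`, `Bmax = 354`, gains `gainOf2371x`).  Proofs only (no new definitions):
* `knapAddB_dom`, `knapAdd_one_dom`: the binary-splitting rows dominate every multiset of inserted items (the `TECert` argument of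
  `AbelianSTPPCensusTECertKnapsack.lean` at `Bmax = 354`, with halved weights `⌊(ab+bc+ca)/2⌋` bounded below per volume;
  `TECert.knapPass` and its cell lemmas are imported, not copied);
* `mem_triples` / `of_mem_triples`: completeness and content of the candidate enumeration `triples` (after `TECert.mem_tierTriples`);
* `minOver_le` / `le_minOver`, `cand_bounds`.
Statements spell the namespace `TAKnap473.` explicitly (the gate's landed-statement key is textual; these lemmas concern this file's
`Mtop = 473` objects, not the homonymous `TAKnap` ones).
Continued in `AbelianSTPPCensusTAKnap473Sound.lean` (row invariant, order walk, volume loop, the maximal-member bridge from `SieveAdmissible`).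
WHAT THIS IS NOT: arithmetic on shape lists only; no statement about STPP families or `ω`.
-/

set_option linter.dupNamespace false
set_option autoImplicit false

namespace Summit.MatrixMultiplication.MatrixMultiplication.Theorems.TAKnap473

open TECert (tableOK vol us knapPass length_knapPass le_getD_knapPass shift_le_getD_knapPass)
open ShapeCert (gainOf2371x)

/-! ## Knapsack rows dominate (binary splitting, verbatim `TECert.knapAdd_dom` at this file's `Bmax`) -/

/-- The binary-splitting insertion dominates every multiplicity `m < 2^fuel` of the item `(kU, kq)`. [bookkeeping] -/
theorem knapAddB_dom (U q : ℕ) (hU : 1 ≤ U) : ∀ (fuel k : ℕ) (row : List ℕ), row.length = TAKnap473.Bmax + 1 →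
    (TAKnap473.knapAdd U q fuel k row).length = TAKnap473.Bmax + 1 ∧
    ∀ m b, m < 2 ^ fuel → m * (k * U) ≤ b → b ≤ TAKnap473.Bmax →
      row.getD (b - m * (k * U)) 0 + m * (k * q) ≤ (TAKnap473.knapAdd U q fuel k row).getD b 0
  | 0, k, row, hlen => by
    refine ⟨by simpa [knapAdd] using hlen, fun m b hm _ _ => ?_⟩
    have : m = 0 := by simpa using hm
    subst this; simp [knapAdd]
  | fuel + 1, k, row, hlen => by
    by_cases hk : k * U ≤ Bmax
    · have hlen' : (knapPass row (k * U) (k * q)).length = Bmax + 1 := by rw [length_knapPass, hlen]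
      obtain ⟨ihlen, ih⟩ := knapAddB_dom U q hU fuel (2 * k) (knapPass row (k * U) (k * q)) hlen'
      have hred : knapAdd U q (fuel + 1) k row = knapAdd U q fuel (2 * k) (knapPass row (k * U) (k * q)) := by
        simp [knapAdd, hU, hk]
      rw [hred]
      refine ⟨ihlen, fun m b hm hmb hb => ?_⟩
      have h2 : m / 2 < 2 ^ fuel := by
        rw [Nat.pow_succ] at hm; omega
      have key := ih (m / 2) b h2 (by
        have : m / 2 * (2 * k * U) ≤ m * (k * U) := by
          rw [show m / 2 * (2 * k * U) = (m / 2 * 2) * (k * U) by ring]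
          exact Nat.mul_le_mul_right _ (Nat.div_mul_le_self m 2)
        omega) hb
      rcases Nat.even_or_odd m with ⟨m', hm'⟩ | ⟨m', hm'⟩
      · have hdiv : m / 2 = m' := by omega
        rw [hdiv] at key
        have e1 : b - m' * (2 * k * U) = b - m * (k * U) := by
          rw [hm']; congr 1; ring
        have e2 : m' * (2 * k * q) = m * (k * q) := by rw [hm']; ring
        rw [e1, e2] at key
        exact le_trans (Nat.add_le_add_right (le_getD_knapPass row (k * U) (k * q) _) _) key
      · have hdiv : m / 2 = m' := by omega
        rw [hdiv] at key
        set c := b - m' * (2 * k * U) with hc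
        have hmk : m * (k * U) = m' * (2 * k * U) + k * U := by rw [hm']; ring
        have hkc : k * U ≤ c := by omega
        have hcl : c < row.length := by rw [hlen]; omega
        have step := shift_le_getD_knapPass row (k * U) (k * q) c hkc hcl
        have e1 : c - k * U = b - m * (k * U) := by omega
        have e2 : m * (k * q) = m' * (2 * k * q) + k * q := by rw [hm']; ring
        rw [e1] at step
        rw [e2]
        calc row.getD (b - m * (k * U)) 0 + (m' * (2 * k * q) + k * q)
            = (row.getD (b - m * (k * U)) 0 + k * q) + m' * (2 * k * q) := by ring
          _ ≤ (knapPass row (k * U) (k * q)).getD c 0 + m' * (2 * k * q) := Nat.add_le_add_right step _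
          _ ≤ _ := key
    · have hred : knapAdd U q (fuel + 1) k row = row := by simp [knapAdd, hk]
      rw [hred]
      refine ⟨hlen, fun m b _ hmb hb => ?_⟩
      have hm0 : m = 0 := by
        by_contra h
        have : 1 * (k * U) ≤ m * (k * U) := Nat.mul_le_mul_right _ (Nat.one_le_iff_ne_zero.mpr h)
        omega
      subst hm0; simp

/-- Domination (halved weights) passes to a smaller class of shapes. [bookkeeping] -/
theorem Dom.weaken {row : List ℕ} {C C' : ℕ × ℕ × ℕ → Prop} (h : TAKnap473.Dom row C) (hCC : ∀ t, C' t → C t) :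
    TAKnap473.Dom row C' :=
  fun G hG b hb hs => h G (fun t ht => hCC t (hG t ht)) b hb hs

/-- Splitting a list of shapes in `C ∨ new` into the number of new members (each of halved weight `≥ U` and value
`gainOf2371x V`) and a list in `C`. [bookkeeping] -/
theorem split_count (C : ℕ × ℕ × ℕ → Prop) (V U : ℕ) :
    ∀ G : List (ℕ × ℕ × ℕ), (∀ t ∈ G, C t ∨ (vol t = V ∧ U ≤ us t / 2)) →
      ∃ (m : ℕ) (G₂ : List (ℕ × ℕ × ℕ)), (∀ t ∈ G₂, C t) ∧
        m * U + (G₂.map fun t => us t / 2).sum ≤ (G.map fun t => us t / 2).sum ∧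
        (G.map fun t => gainOf2371x (vol t)).sum = m * gainOf2371x V + (G₂.map fun t => gainOf2371x (vol t)).sum
  | [], _ => ⟨0, [], by simp, by simp, by simp⟩
  | t :: G, hG => by
    obtain ⟨m, G₂, hG₂, hs, hv⟩ := split_count C V U G (fun t' ht' => hG t' (List.mem_cons_of_mem _ ht'))
    rcases hG t List.mem_cons_self with hC | ⟨hq, hu⟩
    · refine ⟨m, t :: G₂, ?_, ?_, ?_⟩
      · intro t' ht'
        rcases List.mem_cons.mp ht' with rfl | h
        · exact hC
        · exact hG₂ t' h
      · simp only [List.map_cons, List.sum_cons]; omega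
      · simp only [List.map_cons, List.sum_cons, hv]; ring
    · refine ⟨m + 1, G₂, hG₂, ?_, ?_⟩
      · simp only [List.map_cons, List.sum_cons]; nlinarith
      · simp only [List.map_cons, List.sum_cons, hv, hq]; ring

/-- One item insertion: the new row dominates the old class extended by the shapes of volume `V` whose halved weight is at
least `U ≥ 1`. [bookkeeping] -/
theorem knapAdd_one_dom (V U : ℕ) (hU : 1 ≤ U) (row : List ℕ) (hlen : row.length = TAKnap473.Bmax + 1)
    (C : ℕ × ℕ × ℕ → Prop) (hdom : TAKnap473.Dom row C) :
    (TAKnap473.knapAdd U (gainOf2371x V) 10 1 row).length = TAKnap473.Bmax + 1 ∧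
      TAKnap473.Dom (TAKnap473.knapAdd U (gainOf2371x V) 10 1 row) (fun t => C t ∨ (vol t = V ∧ U ≤ us t / 2)) := by
  obtain ⟨hlen', hka⟩ := knapAddB_dom U (gainOf2371x V) hU 10 1 row hlen
  refine ⟨hlen', fun G hG b hb hs => ?_⟩
  obtain ⟨m, G₂, hG₂, hsu, hsv⟩ := split_count C V U G hG
  rw [hsv]
  have hmU : m * U ≤ b := by omega
  have hm : m < 2 ^ 10 := by
    have : m * 1 ≤ m * U := Nat.mul_le_mul_left _ hU
    simp [Bmax] at hb; omega
  have h1 := hdom G₂ hG₂ (b - m * U) (by omega) (by omega)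
  have h2 := hka m b hm (by simpa using hmU) hb
  simp only [one_mul] at h2
  omega

/-! ## The candidate enumeration -/

/-- Completeness of the candidate enumeration (after `TECert.mem_tierTriples`). [bookkeeping] -/
theorem mem_triples {a b c : ℕ} (ha : 1 ≤ a) (hb : 1 ≤ b) (hc : 1 ≤ c) (h : tableOK TAKnap473.Mtop a b c = true) :
    (a, b, c) ∈ TAKnap473.triples (a * b * c) := by
  have hVa : a * b * c / a = b * c := by
    rw [mul_assoc]; exact Nat.mul_div_cancel_left _ (by omega)
  have hVab : b * c / b = c := Nat.mul_div_cancel_left _ (by omega)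
  have haV : a ≤ a * b * c := by
    calc a = a * 1 * 1 := by ring
      _ ≤ a * b * c := Nat.mul_le_mul (Nat.mul_le_mul le_rfl hb) hc
  have hbV : b ≤ b * c := by
    calc b = b * 1 := by ring
      _ ≤ b * c := Nat.mul_le_mul le_rfl hc
  simp only [triples, List.mem_flatMap, List.mem_range]
  refine ⟨a - 1, by omega, ?_⟩
  rw [Nat.sub_add_cancel ha, if_pos (by rw [mul_assoc]; exact Nat.mul_mod_right _ _), List.mem_filterMap]
  refine ⟨b - 1, ?_, ?_⟩
  · rw [List.mem_range, hVa]; omega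
  · rw [Nat.sub_add_cancel hb, hVa, hVab, if_pos ⟨Nat.mul_mod_right _ _, h⟩]

/-- What the candidate enumeration guarantees about its members (after `TECert.of_mem_tierTriples`). [bookkeeping] -/
theorem of_mem_triples {V : ℕ} {t : ℕ × ℕ × ℕ} (ht : t ∈ TAKnap473.triples V) : TAKnap473.Cand t ∧ vol t = V := by
  simp only [triples, List.mem_flatMap, List.mem_range] at ht
  obtain ⟨a', _, hx⟩ := ht
  by_cases h1 : V % (a' + 1) = 0
  · rw [if_pos h1, List.mem_filterMap] at hx
    obtain ⟨b', hb', hy⟩ := hx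
    rw [List.mem_range] at hb'
    by_cases h2 : V / (a' + 1) % (b' + 1) = 0 ∧ tableOK Mtop (a' + 1) (b' + 1) (V / (a' + 1) / (b' + 1)) = true
    · rw [if_pos h2] at hy
      simp only [Option.some.injEq] at hy
      subst hy
      have hd1 : (a' + 1) * (V / (a' + 1)) = V := Nat.mul_div_cancel' (Nat.dvd_of_mod_eq_zero h1)
      have hd2 : (b' + 1) * (V / (a' + 1) / (b' + 1)) = V / (a' + 1) :=
        Nat.mul_div_cancel' (Nat.dvd_of_mod_eq_zero h2.1)
      refine ⟨⟨by simp, by simp, ?_, h2.2⟩, ?_⟩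
      · show 1 ≤ V / (a' + 1) / (b' + 1)
        exact Nat.div_pos (by omega) (by omega)
      · show (a' + 1) * (b' + 1) * (V / (a' + 1) / (b' + 1)) = V
        rw [mul_assoc, hd2, hd1]
    · rw [if_neg h2] at hy; exact absurd hy (by simp)
  · rw [if_neg h1] at hx; exact absurd hx (by simp)

/-- A candidate shape is listed under its volume. [bookkeeping] -/
theorem mem_triples_of_cand {t : ℕ × ℕ × ℕ} (h : TAKnap473.Cand t) : t ∈ TAKnap473.triples (vol t) := by
  obtain ⟨a, b, c⟩ := t
  exact mem_triples h.1 h.2.1 h.2.2.1 h.2.2.2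

/-- `minOver` is below every value of the list. [bookkeeping] -/
theorem minOver_le (f : ℕ × ℕ × ℕ → ℕ) (m₀ : ℕ) : ∀ (ts : List (ℕ × ℕ × ℕ)) (t : ℕ × ℕ × ℕ), t ∈ ts →
    TAKnap473.minOver f m₀ ts ≤ f t
  | [], t, ht => absurd ht (by simp)
  | t' :: ts, t, ht => by
    have hrec : minOver f m₀ (t' :: ts) = f t' - (f t' - minOver f m₀ ts) := by simp [minOver]
    rw [hrec]
    rcases List.mem_cons.mp ht with rfl | h
    · omega
    · have := minOver_le f m₀ ts t h; omega

/-- A common lower bound of the values and the default is below `minOver`. [bookkeeping] -/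
theorem le_minOver (f : ℕ × ℕ × ℕ → ℕ) (m₀ L : ℕ) (h₀ : L ≤ m₀) : ∀ ts : List (ℕ × ℕ × ℕ), (∀ t ∈ ts, L ≤ f t) →
    L ≤ TAKnap473.minOver f m₀ ts
  | [], _ => by simpa [minOver] using h₀
  | t' :: ts, hts => by
    have hrec : minOver f m₀ (t' :: ts) = f t' - (f t' - minOver f m₀ ts) := by simp [minOver]
    rw [hrec]
    have h1 := hts t' List.mem_cons_self
    have h2 := le_minOver f m₀ L h₀ ts (fun t ht => hts t (List.mem_cons_of_mem _ ht))
    omega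

/-- Candidates have pair-product sum `≥ 3`, excess `≥ 3` and positive volume. [bookkeeping] -/
theorem cand_bounds {t : ℕ × ℕ × ℕ} (h : TAKnap473.Cand t) : 3 ≤ us t ∧ 3 ≤ TAKnap473.dd t ∧ 1 ≤ vol t := by
  obtain ⟨a, b, c⟩ := t
  obtain ⟨ha, hb, hc, -⟩ := h
  simp only [us, TECert.uu, TECert.vv, TECert.ww, dd, vol] at *
  have h1 : 1 ≤ a * b := Nat.mul_pos ha hb
  have h2 : 1 ≤ b * c := Nat.mul_pos hb hc
  have h3 : 1 ≤ c * a := Nat.mul_pos hc ha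
  refine ⟨by omega, ?_, Nat.mul_pos h1 hc⟩
  have e1 : a + b ≤ 2 * (a * b) := by nlinarith
  have e2 : b + c ≤ 2 * (b * c) := by nlinarith
  have e3 : c + a ≤ 2 * (c * a) := by nlinarith
  omega


end Summit.MatrixMultiplication.MatrixMultiplication.Theorems.TAKnap473
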